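import Mathlib
import Literature.Analysis.FluidPDE.VectorCalculus

/-!
# Tool stub `stub_lambVectorIsBernoulliGradient` of the line `Sketch`
# (crux `DyadicWallCascade.HalfSpaceHierarchy`, item stmt-AnomalousDissipation-18627)

Sorry-free discharge of the registered tool stub `stub_lambVectorIsBernoulliGradient` of the lead's
skeleton `Cruxes/HalfSpaceHierarchy/Lines/Sketch.lean` (card `flat-bernoulli-leaves`, companion identity:
the Bernoulli function `B = ‖V‖² / 2 + Q` of a steady Euler flow governs the energy flux `F = ∫ V₃ B` of
the crux).

**Statement (Lamb-vector identity for steady Euler flows).**  Let `U ⊆ ℝ³` be open, let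
`V : ℝ³ → ℝ³` and `Q : ℝ³ → ℝ` be `C¹` on `U`, and suppose the steady incompressible Euler momentum
equation `(V·∇)V + ∇Q = 0` holds on `U` in the form `DV(X)[V X] + ∇Q(X) = 0` (`X ∈ U`).  Then on `U`
the Lamb vector is the gradient of the Bernoulli function:
`V × curl V = ∇(‖V‖² / 2 + Q)`.
Here `cross` / `curl` are the tree's `Literature.Analysis.FluidPDE.cross` / `.curl`
(`Literature/Analysis/FluidPDE/VectorCalculus.lean`) and `gradient` is Mathlib's.

**Proof.**  Fix `X ∈ U`; since `U ∈ 𝓝 X`, `V` and `Q` are differentiable at `X`.  Write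
`eᵢ = EuclideanSpace.single i 1`, `v = V X`, `Dⱼᵢ = (DV(X) eⱼ)ᵢ = ∂ⱼVᵢ(X)`.
* coordinates of a gradient are directional derivatives, `(∇f X)ᵢ = Df(X) eᵢ` (Riesz;
  `gradient_coord`);
* chain rule for `‖·‖²` (Mathlib's `HasFDerivAt.norm_sq`) and additivity:
  `D(‖V‖²/2 + Q)(X) h = ⟪v, DV(X) h⟫ + DQ(X) h` (`fderiv_bernoulli_apply`), and
  `⟪v, DV(X) eᵢ⟫ = Σⱼ vⱼ Dᵢⱼ`;
* the Euler equation in coordinates, with `v = Σⱼ vⱼ eⱼ` and linearity of `DV(X)`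
  (`clm_apply_coord`): `(∇Q X)ᵢ = −(DV(X) v)ᵢ = −Σⱼ vⱼ Dⱼᵢ`;
* both sides are now explicit polynomials in the nine numbers `Dⱼᵢ` and the three `vⱼ`; e.g. the
  first coordinate of `v × curl V X` is `v₁(D₀₁ − D₁₀) − v₂(D₂₀ − D₀₂)`, that of the right-hand side is
  `(v₀D₀₀ + v₁D₀₁ + v₂D₀₂) − (v₀D₀₀ + v₁D₁₀ + v₂D₂₀)`, and `ring` closes each of the three coordinates.

Source: folklore vector calculus, `(V·∇)V = ∇(‖V‖²/2) − V × curl V` (A. J. Majda, A. L. Bertozzi,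
*Vorticity and Incompressible Flow*, CUP 2002, §1.1 and eq. (1.33); H. Lamb, *Hydrodynamics*, 6th ed.
(1932), Arts. 146, 165); card `flat-bernoulli-leaves`.  No named facts are used; the only tree import is
`VectorCalculus.lean`.  Deliberately NOT here: the time-dependent and the viscous versions of the
identity, and its converse (a Lamb vector that is a gradient gives a steady Euler flow).
-/

set_option linter.dupNamespace false

noncomputable section

open scoped InnerProductSpace RealInnerProductSpace
open Literature.Analysis.FluidPDE

namespace Summit.AnomalousDissipation.AnomalousDissipation.Theorems.HalfSpaceHierarchy

/-- Coordinates of a gradient on `ℝ³` are the directional derivatives along the standard basis,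
`(∇f X)ᵢ = Df(X) eᵢ` with `eᵢ = EuclideanSpace.single i 1` (Riesz representation, Mathlib's
`InnerProductSpace.toDual_symm_apply`; a copy of the tree's `gradient_apply_eq_fderiv_single` of
`Literature/Analysis/FluidPDE/AxisymGradientField.lean`, restated privately to keep this file's tree
imports to `VectorCalculus`). [folklore] -/
private theorem gradient_coord (f : EuclideanSpace ℝ (Fin 3) → ℝ) (X : EuclideanSpace ℝ (Fin 3))
    (i : Fin 3) : gradient f X i = fderiv ℝ f X (EuclideanSpace.single i 1) := by
  have h1 : ⟪gradient f X, EuclideanSpace.single i (1 : ℝ)⟫ = gradient f X i := by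
    simp only [EuclideanSpace.inner_single_right, one_mul, RCLike.conj_to_real]
  rw [← h1, gradient, InnerProductSpace.toDual_symm_apply]

/-- Expansion of a continuous linear map of `ℝ³` in standard coordinates,
`(L v)ᵢ = Σⱼ vⱼ (L eⱼ)ᵢ`, from `v = Σⱼ vⱼ eⱼ` (`EuclideanSpace.basisFun`) and linearity (same idiom as
the tree's `clm_apply_coord` of `Literature/Analysis/FluidPDE/VorticityStretching.lean`). [folklore] -/
private theorem clm_apply_coord (L : EuclideanSpace ℝ (Fin 3) →L[ℝ] EuclideanSpace ℝ (Fin 3))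
    (v : EuclideanSpace ℝ (Fin 3)) (i : Fin 3) :
    L v i = ∑ j, v j * L (EuclideanSpace.single j 1) i := by
  have hv : v = ∑ j, v j • EuclideanSpace.single j (1 : ℝ) := by
    simpa using ((EuclideanSpace.basisFun (Fin 3) ℝ).sum_repr v).symm
  conv_lhs => rw [hv]
  simp [map_sum, map_smul, Finset.sum_apply]

/-- Derivative of the Bernoulli function of a pair `(V, Q)` differentiable at `X`:
`D(‖V‖²/2 + Q)(X) h = ⟪V X, DV(X) h⟫ + DQ(X) h` (chain rule for `‖·‖²`, Mathlib's
`HasFDerivAt.norm_sq`, and additivity of the derivative). [folklore] -/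
private theorem fderiv_bernoulli_apply
    {V : EuclideanSpace ℝ (Fin 3) → EuclideanSpace ℝ (Fin 3)} {Q : EuclideanSpace ℝ (Fin 3) → ℝ}
    {X : EuclideanSpace ℝ (Fin 3)} (hV : DifferentiableAt ℝ V X) (hQ : DifferentiableAt ℝ Q X)
    (h : EuclideanSpace ℝ (Fin 3)) :
    fderiv ℝ (fun Y => ‖V Y‖ ^ 2 / 2 + Q Y) X h = ⟪V X, fderiv ℝ V X h⟫ + fderiv ℝ Q X h := by
  have h1 : HasFDerivAt (fun Y => ‖V Y‖ ^ 2 * (2 : ℝ)⁻¹ + Q Y)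
      ((2 : ℝ)⁻¹ • (2 • (innerSL ℝ (V X)).comp (fderiv ℝ V X)) + fderiv ℝ Q X) X :=
    (hV.hasFDerivAt.norm_sq.mul_const (2 : ℝ)⁻¹).add hQ.hasFDerivAt
  have h2 : (fun Y => ‖V Y‖ ^ 2 / 2 + Q Y) = fun Y => ‖V Y‖ ^ 2 * (2 : ℝ)⁻¹ + Q Y := by
    funext Y
    rw [div_eq_mul_inv]
  rw [h2, h1.fderiv]
  simp only [_root_.add_apply, _root_.smul_apply, ContinuousLinearMap.comp_apply,
    innerSL_apply_apply, smul_eq_mul, nsmul_eq_mul, Nat.cast_ofNat]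
  ring

/-- **Tool stub `stub_lambVectorIsBernoulliGradient` (Lamb-vector identity for steady Euler flows).**
For `U ⊆ ℝ³` open, `V : ℝ³ → ℝ³` and `Q : ℝ³ → ℝ` of class `C¹` on `U` with
`DV(X)[V X] + ∇Q(X) = 0` on `U` (the steady Euler equation `(V·∇)V + ∇Q = 0`), the Lamb vector is the
gradient of the Bernoulli function on `U`: `V × curl V = ∇(‖V‖² / 2 + Q)`.  Proof: coordinates; see the
module docstring (Majda–Bertozzi, *Vorticity and Incompressible Flow*, §1.1, eq. (1.33); Lamb,
*Hydrodynamics*, Art. 146). [folklore] -/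
theorem stub_lambVectorIsBernoulliGradient :
    ∀ (V : EuclideanSpace ℝ (Fin 3) → EuclideanSpace ℝ (Fin 3)) (Q : EuclideanSpace ℝ (Fin 3) → ℝ)
      (U : Set (EuclideanSpace ℝ (Fin 3))), IsOpen U →
      ContDiffOn ℝ 1 V U → ContDiffOn ℝ 1 Q U →
      (∀ X ∈ U, (fderiv ℝ V X) (V X) + gradient Q X = 0) →
      ∀ X ∈ U, cross (V X) (curl V X) = gradient (fun Y => ‖V Y‖ ^ 2 / 2 + Q Y) X := by
  intro V Q U hU hV hQ hEuler X hX
  have hVd : DifferentiableAt ℝ V X :=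
    (hV.contDiffAt (hU.mem_nhds hX)).differentiableAt one_ne_zero
  have hQd : DifferentiableAt ℝ Q X :=
    (hQ.contDiffAt (hU.mem_nhds hX)).differentiableAt one_ne_zero
  -- the Euler equation in coordinates: `(∇Q X)ᵢ = -Σⱼ vⱼ Dⱼᵢ`
  have hQi : ∀ i : Fin 3, gradient Q X i =
      -∑ j, V X j * fderiv ℝ V X (EuclideanSpace.single j 1) i := by
    intro i
    have h := congrArg (fun w : EuclideanSpace ℝ (Fin 3) => w i) (hEuler X hX)
    simp only [PiLp.add_apply, PiLp.zero_apply] at h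
    rw [← clm_apply_coord]
    linarith
  ext i
  rw [gradient_coord, fderiv_bernoulli_apply hVd hQd, ← gradient_coord, hQi i]
  fin_cases i <;>
    simp [cross, curl, cross_apply, PiLp.inner_apply, Fin.sum_univ_three] <;> ring

end Summit.AnomalousDissipation.AnomalousDissipation.Theorems.HalfSpaceHierarchy

end
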